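import Literature.AlgebraicGeometry.Frobenioids.ArchimedeanFSM
import Literature.AlgebraicGeometry.Frobenioids.ArchimedeanFSMIrreducible
import Literature.AlgebraicGeometry.Frobenioids.ArchimedeanFSMLifting
import Literature.AlgebraicGeometry.Frobenioids.ArchimedeanPullbacks
import Literature.AlgebraicGeometry.Frobenioids.FSMIMorphisms
import HarnessLib

/-!
# Frobenioids II, Proposition 3.4 (viii), condition (a) for `F = A`: the MODEL LEMMAS of the
# angular Frobenioid `A = A₀ ×_{D₀} D` consumed by the abstract assembly
# (abc-iut cell, layer L1, sub-node `FrdII:Prop3.4(viii)/P34-L14`, pieces M1–M5 for the tower `towerA`)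

Mochizuki, *The geometry of Frobenioids II: poly-Frobenioids*, Kyushu J. Math. **62** (2008)
401–460, §3, Proposition 3.4 (viii), proof p. 33 ll. 16–44 [cite: MochizukiFrdII2008, Prop 3.4 (viii) p.33].

PROOF-ONLY file (nothing is defined). For the tower `towerA π` (`F = A π`, the wide subcategory of
`C = C₀ ×_{D₀} D` on the isometries; `F₀ = A₀`; seat abc-iut-L1-t6's `AngularFrobenioidsRelative`,
`ArchimedeanFSM`) and the class of arrows
`P α := "the C₀-component of α is a pull-back morphism of C₀"` (`PreFrobenioid.IsPullbackMorphism
C0.toElem α.hom.fst`; by `A0.isPullbackMorphism_of_hom` below this implies that `α` projects to a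
pull-back morphism of `A₀`, the hypothesis of the typed item (vii)), this file proves the model
hypotheses of `FSMFFTransfer.exists_isFSMIChain_of_isFSM` (`ArchimedeanFSMFFTransfer.lean`):

* (Mono) `A.mono_of_isIso_snd_of_mono_toA0`, (PMono) `A.mono_of_isPullbackMorphism_fst`,
  (Iso) = `A.isIso_of_isIso_proj` (landed, `ArchimedeanFSMIrreducible`), (PIso)
  `A.isIso_of_isPullbackMorphism_fst_of_isIso_snd`, (v) `ArchFrd.Tower.isFSMI_of_propV` (any tower);
* (LiftF₀) `A.exists_lift_toA0_fac` — a factorisation in `A₀` of the `A₀`-projection of an arrow `β`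
  over an isomorphism of `D`, whose first member lies over an isomorphism of `D₀`, lifts to `A` with
  first member over an identity of `D` (purely formal in the fibre product);
* (Fac) `A.exists_fac_pullback` — every arrow `φ` of `A` factors as `β ≫ α` with `β` over an identity
  of `D` and `α` with pull-back `C₀`-component ("`φ₀ = α₀ ∘ β₀` with `α₀` a pull-back morphism and
  `β₀` a base-isomorphism … lifts naturally", p. 33 ll. 17–20: the pulled-back angular region
  `A_K|_L` of Def. 3.1 (iv) and the cartesian factorisation over `𝟙`);
* (LiftD) `A.exists_factor_pullback` — item (vi) REFINED: if the `C₀`-component of `α` is a pull-back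
  morphism, the two members of the lift of a factorisation of `α_D` (constructed as in t6's
  `C.exists_factor`, through the object carrying the pulled-back region) again have pull-back
  `C₀`-components (`C0.exists_factor_pullRegion` records the region equality that t6's statement
  elides);
* `A0.isPullbackMorphism_of_hom` — an isometry of `C₀` that is a pull-back morphism of `C₀` is a
  pull-back morphism of `A₀` (cartesian lifts of isometries along an isometric pull-back are isometries).

No side is taken on [IUTchIII] Cor. 3.12.
-/

namespace Literature.AlgebraicGeometry.Frobenioids

open CategoryTheory Set
open scoped Pointwise

noncomputable section

/-! ### A generic remark on categorical fibre products -/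

namespace CFP

universe v₁ v₂ v₃ u₁ u₂ u₃

variable {C₁ : Type u₁} [Category.{v₁} C₁] {C₂ : Type u₂} [Category.{v₂} C₂] {E : Type u₃}
  [Category.{v₃} E] {Φ₁ : C₁ ⥤ E} {Φ₂ : C₂ ⥤ E}

/-- An arrow of `C₁ ×_E C₂` both of whose components are monomorphisms is a monomorphism.
[cite: MochizukiFrdI2008, §0 p.17] -/
theorem mono_of_mono_fst_snd {X Y : CFP Φ₁ Φ₂} (f : X ⟶ Y) [Mono f.fst] [Mono f.snd] : Mono f :=
  ⟨fun g h hgh => hom_ext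
    ((cancel_mono f.fst).mp (by rw [← comp_fst, ← comp_fst, hgh]))
    ((cancel_mono f.snd).mp (by rw [← comp_snd, ← comp_snd, hgh]))⟩

/-- In `C₁ ×_E C₂`, two arrows with the same domain, codomain and `C₂`-component have
`C₁`-components with the same image in `E`. [cite: MochizukiFrdI2008, §0 p.17] -/
theorem map_fst_eq_of_snd_eq {X Y : CFP Φ₁ Φ₂} (g h : X ⟶ Y) (hs : g.snd = h.snd) :
    Φ₁.map g.fst = Φ₁.map h.fst := by
  rw [← cancel_mono Y.iso.hom, g.w, h.w, hs]

end CFP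

namespace ArchFrd

universe v u

/-! ### Any tower: the FSMI form of the second projection pattern of item (v) -/

namespace Tower

variable {D : Type u} [Category.{v} D] {π : D ⥤ D0} (T : Tower π)

/-- From the typed item (v) of a tower (second projection pattern): an FSM-morphism over an
isomorphism of `D` whose `F₀`-projection is an FSMI-morphism is an FSMI-morphism (its projection to
`D₀`, through `D`, is then an isomorphism). [cite: MochizukiFrdII2008, Prop 3.4 (v) p.30] -/
theorem isFSMI_of_propV (hV : T.PropV) {X Y : T.F} (ψ : X ⟶ Y) (hG : IsIso (T.toD.map ψ))
    (hψ : IsFSM ψ) (h0 : IsFSMI (T.toF0.map ψ)) : IsFSMI ψ := by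
  have hD0 : IsIso (T.toD0.map ψ) := by
    change IsIso (π.map (T.toD.map ψ))
    infer_instance
  exact ⟨hψ, (hV ψ).2.1 hG h0.2 hD0⟩

end Tower

/-! ### `C₀`: the factorisation of item (vi) with the pulled-back region recorded -/

namespace C0

variable {X Y : C0}

/-- t6's `C0.exists_factor` (proof of Prop. 3.4 (vi) at the level of `C₀`) with one more conclusion
recorded: the middle object carries EXACTLY the pulled-back region `A_K|_L` (Def. 3.1 (iv)), i.e.
`A.carrier = pullRegion Y α_b`. [cite: MochizukiFrdII2008, Prop 3.4 (vi) p.30] -/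
theorem exists_factor_pullRegion (φ : X ⟶ Y) {L : D0} (βb : X.base ⟶ L) (αb : L ⟶ Y.base)
    (h : βb ≫ αb = Base φ) :
    ∃ (A : AngularRegion ℂ) (hA : L = D0.real → A.IsIsotropic)
      (β : X ⟶ C0.mk L A hA) (α : C0.mk L A hA ⟶ Y),
      β ≫ α = φ ∧ Base β = βb ∧ Base α = αb ∧ degFr β = degFr φ ∧ scalar β = scalar φ ∧
        div β = div φ ∧ degFr α = 1 ∧ scalar α = 1 ∧ PreFrobenioid.IsIsometry toElem α ∧
        A.carrier = pullRegion Y αb := by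
  obtain ⟨A, hcar, htip, -, hiso⟩ := exists_pulledRegion Y αb
  have hYb : L = D0.real → Y.base = D0.real := by
    rintro rfl
    obtain ⟨K, R, hR⟩ := Y
    cases K with
    | real => rfl
    | complex => exact (D0.isEmpty_hom_real_complex.false αb).elim
  have hA : L = D0.real → A.IsIsotropic := fun hL => hiso (Y.isIsotropic_of_isReal (hYb hL))
  have hmβ : scalar φ • X.region.carrier ^ (degFr φ : ℕ) ⊆ pullRegion (C0.mk L A hA) βb := by
    show scalar φ • X.region.carrier ^ (degFr φ : ℕ) ⊆ βb.act '' A.carrier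
    rw [hcar, ← pullRegion_comp, h]
    exact φ.mapsTo
  have hmα : (1 : ℂˣ) • (C0.mk L A hA).region.carrier ^ ((1 : ℕ+) : ℕ) ⊆ pullRegion Y αb := by
    rw [one_smul, PNat.one_coe, pow_one]
    exact hcar.le
  have htip' : (C0.mk L A hA).tip = Y.tip := by
    show (A.tip : ℝ) = (Y.region.tip : ℝ)
    rw [htip]
  refine ⟨A, hA, ⟨βb, degFr φ, scalar φ, φ.scalar_mem, hmβ⟩, ⟨αb, 1, 1, one_mem _, hmα⟩, ?_, rfl,
    rfl, rfl, rfl, div_eq_of_tip_eq φ _ rfl rfl htip', rfl, rfl, ?_, hcar⟩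
  · refine C0.hom_ext h (mul_one _) ?_
    show βb.act 1 * scalar φ ^ ((1 : ℕ+) : ℕ) = scalar φ
    rw [map_one, PNat.one_coe, pow_one, one_mul]
  · rw [A0.isIsometry_iff_norm_mul_tip_pow]
    show ‖((1 : ℂˣ) : ℂ)‖ * (C0.mk L A hA).tip ^ ((1 : ℕ+) : ℕ) = Y.tip
    rw [Units.val_one, norm_one, one_mul, PNat.one_coe, pow_one]
    exact htip'

/-- A `C₀`-arrow `(f, 1, 1)` out of the object carrying exactly the pulled-back region `A_K|_f` is a
pull-back morphism of `C₀` (Ex. 3.3 (ii): `d = 1` and `c · A_L = A_K|_L`).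
[cite: MochizukiFrdII2008, Ex 3.3 (ii) p.28] -/
theorem isPullbackMorphism_of_region_eq (α : X ⟶ Y) (hd : degFr α = 1) (hs : scalar α = 1)
    (hcar : X.region.carrier = pullRegion Y (Base α)) :
    PreFrobenioid.IsPullbackMorphism toElem α := by
  rw [isPullbackMorphism_iff]
  exact ⟨hd, by rw [hs, one_smul, hcar]⟩

/-- If `β ≫ α` has pull-back data `c · A_X = A_Y|_{Base(β ≫ α)}` with `β`, `α` linear, `α = (α_b, 1, 1)`
out of the object carrying `A_Y|_{α_b}`, then `β` is a pull-back morphism too: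
`c · A_X = (A_Y|_{α_b})|_{β_b}`. [cite: MochizukiFrdII2008, Ex 3.3 (ii) p.28] -/
theorem isPullbackMorphism_left_of_region_eq {Z : C0} (β : X ⟶ Z) (α : Z ⟶ Y)
    (hdβ : degFr β = 1) (hdα : degFr α = 1) (hsα : scalar α = 1)
    (hcarZ : Z.region.carrier = pullRegion Y (Base α))
    (hfull : scalar (β ≫ α) • X.region.carrier = pullRegion Y (Base (β ≫ α))) :
    PreFrobenioid.IsPullbackMorphism toElem β := by
  rw [isPullbackMorphism_iff]
  refine ⟨hdβ, ?_⟩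
  have hsc : scalar (β ≫ α) = scalar β := by
    rw [scalar_comp', hsα, map_one, one_mul, hdα, PNat.one_coe, pow_one]
  rw [← hsc, hfull, base_comp', pullRegion_comp]
  show (Base β).act '' (pullRegion Y (Base α)) = (Base β).act '' Z.region.carrier
  rw [hcarZ]

end C0

/-! ### `A₀`: pull-back morphisms -/

namespace A0

/-- An arrow of `A₀` whose underlying arrow of `C₀` is a pull-back morphism of `C₀` is a pull-back
morphism of `A₀` (for `A₀ → F_0` over `D₀`): cartesian lifts along an isometric pull-back morphism of
isometries are isometries, since `Div(γ ≫ α) = Div(α) · Div(γ)^{deg α}` and `Φ₀ = ℝ_{≥0}`.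
[cite: MochizukiFrdII2008, Ex 3.3 (iii) p.29] -/
theorem isPullbackMorphism_of_hom {U V : A0} (α : U ⟶ V)
    (hα : PreFrobenioid.IsPullbackMorphism C0.toElem α.hom) :
    PreFrobenioid.IsPullbackMorphism A0.toElem α := by
  intro W
  constructor
  · intro γ γ' hγ
    apply WideSubcategory.hom_ext
    apply (hα W.obj).1
    apply Subtype.ext
    have h1 := congrArg (fun p : PreFrobenioid.PullbackHomData A0.toElem α W => p.1.1) hγ
    have h2 := congrArg (fun p : PreFrobenioid.PullbackHomData A0.toElem α W => p.1.2) hγ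
    exact Prod.ext (congrArg (fun k : W ⟶ V => k.hom) h1) h2
  · rintro ⟨⟨γ', g⟩, hw⟩
    obtain ⟨γc, hγc⟩ := (hα W.obj).2 ⟨(γ'.hom, g), hw⟩
    have h1 : γc ≫ α.hom = γ'.hom :=
      congrArg (fun p : PreFrobenioid.PullbackHomData C0.toElem α.hom W.obj => p.1.1) hγc
    have h2 : C0.Base γc = g :=
      congrArg (fun p : PreFrobenioid.PullbackHomData C0.toElem α.hom W.obj => p.1.2) hγc
    have hγiso : PreFrobenioid.isometricMorphisms C0.toElem γc := by
      have hα1 : C0.div α.hom = 1 := α.property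
      have hγ' : C0.div γ'.hom = 1 := γ'.property
      have hd : C0.degFr α.hom = 1 := ((C0.isPullbackMorphism_iff α.hom).1 hα).1
      change C0.div γc = 1
      have := C0.div_comp γc α.hom
      rw [h1, hγ', hα1, one_mul, hd, PNat.one_coe, pow_one] at this
      exact this.symm
    refine ⟨⟨γc, hγiso⟩, Subtype.ext (Prod.ext ?_ h2)⟩
    exact WideSubcategory.hom_ext _ h1

end A0

/-! ### The tower `towerA`: formal pieces -/

variable {D : Type u} [Category.{v} D] (π : D ⥤ D0)

/-- The projection of `towerA` to `D` on arrows: the `D`-component. [cite: MochizukiFrdII2008, Prop 3.4 p.29] -/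
theorem A.towerA_toD_map {X Y : (towerA π).F} (f : X ⟶ Y) : (towerA π).toD.map f = f.hom.snd := rfl

/-- The projection of `towerA` to `A₀` on arrows: the `C₀`-component with its isometry witness.
[cite: MochizukiFrdII2008, Prop 3.4 p.29] -/
theorem A.towerA_toF0_map_hom {X Y : (towerA π).F} (f : X ⟶ Y) :
    ((towerA π).toF0.map f).hom = f.hom.fst := rfl

/-- Components of composites in `A` (`D`-components). [cite: MochizukiFrdII2008, Ex 3.3 (iii) p.29] -/
theorem A.comp_hom_snd {X Y Z : (towerA π).F} (g : X ⟶ Y) (f : Y ⟶ Z) :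
    (g ≫ f).hom.snd = g.hom.snd ≫ f.hom.snd := rfl

/-- Components of composites in `A` (`C₀`-components). [cite: MochizukiFrdII2008, Ex 3.3 (iii) p.29] -/
theorem A.comp_hom_fst {X Y Z : (towerA π).F} (g : X ⟶ Y) (f : Y ⟶ Z) :
    (g ≫ f).hom.fst = g.hom.fst ≫ f.hom.fst := rfl

/-- (Mono) for `A`: an arrow over an isomorphism of `D` whose projection to `A₀` is a monomorphism is
a monomorphism. [cite: MochizukiFrdII2008, Prop 3.4 (viii) p.33] -/
theorem A.mono_of_isIso_snd_of_mono_toA0 {X Y : (towerA π).F} (f : X ⟶ Y)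
    (hD : IsIso ((towerA π).toD.map f)) (h0 : Mono ((towerA π).toF0.map f)) : Mono f := by
  refine ⟨fun g h hgh => WideSubcategory.hom_ext _ (CFP.hom_ext ?_ ?_)⟩
  · have e : (towerA π).toF0.map g ≫ (towerA π).toF0.map f =
        (towerA π).toF0.map h ≫ (towerA π).toF0.map f := by
      rw [← Functor.map_comp, ← Functor.map_comp, hgh]
    have e' := (cancel_mono _).mp e
    exact congrArg (fun k => InducedWideCategory.Hom.hom k) e'
  · haveI : IsIso f.hom.snd := hD
    have e : g.hom.snd ≫ f.hom.snd = h.hom.snd ≫ f.hom.snd := by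
      rw [← A.comp_hom_snd, ← A.comp_hom_snd, hgh]
    exact (cancel_mono _).mp e

/-- (PMono) for `A`: an arrow whose `C₀`-component is a pull-back morphism of `C₀` and whose
`D`-component is a monomorphism is a monomorphism (cartesian uniqueness in `C₀`).
[cite: MochizukiFrdII2008, Prop 3.4 (viii) p.33] -/
theorem A.mono_of_isPullbackMorphism_fst {Z Y : (towerA π).F} (α : Z ⟶ Y)
    (hP : PreFrobenioid.IsPullbackMorphism C0.toElem α.hom.fst) (hD : Mono ((towerA π).toD.map α)) :
    Mono α := by
  haveI : Mono α.hom.snd := hD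
  refine ⟨fun g h hgh => ?_⟩
  have hs : g.hom.snd = h.hom.snd :=
    (cancel_mono α.hom.snd).mp (by rw [← A.comp_hom_snd, ← A.comp_hom_snd, hgh])
  refine WideSubcategory.hom_ext _ (CFP.hom_ext ?_ hs)
  have hb : C0.Base g.hom.fst = C0.Base h.hom.fst := CFP.map_fst_eq_of_snd_eq g.hom h.hom hs
  apply (hP _).1
  apply Subtype.ext
  refine Prod.ext ?_ hb
  change g.hom.fst ≫ α.hom.fst = h.hom.fst ≫ α.hom.fst
  rw [← A.comp_hom_fst, ← A.comp_hom_fst, hgh]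

/-- An arrow of `A` both of whose components (`C₀` and `D`) are isomorphisms is an isomorphism (the
inverse is again an isometry). [cite: MochizukiFrdII2008, Ex 3.3 (iii) p.29] -/
theorem A.isIso_of_isIso_fst_snd {X Y : (towerA π).F} (φ : X ⟶ Y) [IsIso φ.hom.fst]
    [IsIso φ.hom.snd] : IsIso φ := by
  haveI : IsIso φ.hom := CFP.isIso_of_isIso_fst_snd φ.hom
  exact ⟨⟨⟨inv φ.hom, C.isIsometry_inv π φ.hom⟩, WideSubcategory.hom_ext _ (IsIso.hom_inv_id φ.hom),
    WideSubcategory.hom_ext _ (IsIso.inv_hom_id φ.hom)⟩⟩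

/-- The base of the `C₀`-component of an arrow of `A` over an isomorphism of `D` is an isomorphism of
`D₀` (it is conjugate to the image of the `D`-component under `π`).
[cite: MochizukiFrdII2008, Ex 3.3 (iii) p.29] -/
theorem A.isBaseIso_fst_of_isIso_snd {Z Y : (towerA π).F} (α : Z ⟶ Y)
    (hD : IsIso ((towerA π).toD.map α)) : PreFrobenioid.IsBaseIso C0.toElem α.hom.fst := by
  haveI : IsIso α.hom.snd := hD
  have hw := α.hom.w
  haveI : IsIso ((PreFrobenioid.baseFunctor C0.toElem).map α.hom.fst ≫ Y.obj.iso.hom) := by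
    rw [hw]; infer_instance
  exact IsIso.of_isIso_comp_right ((PreFrobenioid.baseFunctor C0.toElem).map α.hom.fst) Y.obj.iso.hom

/-- (PIso) for `A`: an arrow whose `C₀`-component is a pull-back morphism of `C₀` and whose
`D`-component is an isomorphism is an isomorphism ([FrdI] Def. 1.2 (ii): a pull-back morphism that is a
base-isomorphism is an isomorphism). [cite: MochizukiFrdII2008, Prop 3.4 (viii) p.33] -/
theorem A.isIso_of_isPullbackMorphism_fst_of_isIso_snd {Z Y : (towerA π).F} (α : Z ⟶ Y)
    (hP : PreFrobenioid.IsPullbackMorphism C0.toElem α.hom.fst) (hD : IsIso ((towerA π).toD.map α)) :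
    IsIso α := by
  haveI : IsIso α.hom.snd := hD
  haveI : IsIso α.hom.fst :=
    (PreFrobenioid.isPullbackMorphism_and_isBaseIso_iff_isIso C0.toElem α.hom.fst).1
      ⟨hP, A.isBaseIso_fst_of_isIso_snd π α hD⟩
  exact A.isIso_of_isIso_fst_snd π α

/-! ### The tower `towerA`: lifting `A₀`-factorisations (LiftF₀) -/

/-- (LiftF₀) for `A`: a factorisation `ε ≫ χ` in `A₀` of the `A₀`-projection of an arrow `β` of `A`,
whose first member `ε` lies over an ISOMORPHISM of `D₀`, lifts to a factorisation `β = β₁ ≫ β₂` in `A`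
with `β₁ = (ε, 𝟙)` over an identity of `D` and `β₂ = (χ, β_D)` — purely formal in the fibre product
`A₀ ×_{D₀} D` (the middle object re-uses the `D`-component of the domain).
[cite: MochizukiFrdII2008, Prop 3.4 (viii) p.33] -/
theorem A.exists_lift_toA0_fac {X Z : (towerA π).F} (β : X ⟶ Z)
    {W₀ : (towerA π).F0} (ε : (towerA π).toF0.obj X ⟶ W₀) (χ : W₀ ⟶ (towerA π).toF0.obj Z)
    (hfac : ε ≫ χ = (towerA π).toF0.map β) (hε : PreFrobenioid.IsBaseIso C0.toElem ε.hom) :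
    ∃ (W : (towerA π).F) (β₁ : X ⟶ W) (β₂ : W ⟶ Z) (i : (towerA π).toF0.obj W ≅ W₀),
      β₁ ≫ β₂ = β ∧ IsIso ((towerA π).toD.map β₁) ∧ (towerA π).toF0.map β₁ ≫ i.hom = ε ∧
        i.inv ≫ (towerA π).toF0.map β₂ = χ := by
  obtain ⟨⟨X0, XD, ιX⟩⟩ := X
  obtain ⟨⟨Z0, ZD, ιZ⟩⟩ := Z
  obtain ⟨⟨f0, fD, w⟩, hf⟩ := β
  obtain ⟨W0⟩ := W₀
  obtain ⟨e0, he⟩ := ε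
  obtain ⟨c0, hc⟩ := χ
  change X0 ⟶ W0 at e0
  change W0 ⟶ Z0 at c0
  have hfst : e0 ≫ c0 = f0 := congrArg (fun k => InducedWideCategory.Hom.hom k) hfac
  haveI : IsIso ((PreFrobenioid.baseFunctor C0.toElem).map e0) := hε
  let ιW : (PreFrobenioid.baseFunctor C0.toElem).obj W0 ≅ π.obj XD :=
    (asIso ((PreFrobenioid.baseFunctor C0.toElem).map e0)).symm ≪≫ ιX
  let W : (towerA π).F := ⟨⟨W0, XD, ιW⟩⟩
  have w₁ : (PreFrobenioid.baseFunctor C0.toElem).map e0 ≫ ιW.hom = ιX.hom ≫ π.map (𝟙 XD) := by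
    simp [ιW]
  have w₂ : (PreFrobenioid.baseFunctor C0.toElem).map c0 ≫ ιZ.hom = ιW.hom ≫ π.map fD := by
    simp only [ιW, Iso.trans_hom, Iso.symm_hom, asIso_inv, Category.assoc]
    rw [← w, ← hfst, Functor.map_comp, Category.assoc, IsIso.inv_hom_id_assoc]
  have he1 : PreFrobenioid.Div C0.toElem e0 = 1 := he
  have hc1 : PreFrobenioid.Div C0.toElem c0 = 1 := hc
  have p₁ : PreFrobenioid.isometricMorphisms (C.toElem π)
      (⟨e0, 𝟙 XD, w₁⟩ : (⟨X0, XD, ιX⟩ : C π) ⟶ ⟨W0, XD, ιW⟩) := by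
    change pull _ _ (PreFrobenioid.Div C0.toElem e0) = 1
    rw [he1, map_one]
  have p₂ : PreFrobenioid.isometricMorphisms (C.toElem π)
      (⟨c0, fD, w₂⟩ : (⟨W0, XD, ιW⟩ : C π) ⟶ ⟨Z0, ZD, ιZ⟩) := by
    change pull _ _ (PreFrobenioid.Div C0.toElem c0) = 1
    rw [hc1, map_one]
  refine ⟨W, ⟨⟨e0, 𝟙 XD, w₁⟩, p₁⟩, ⟨⟨c0, fD, w₂⟩, p₂⟩, Iso.refl _,
    WideSubcategory.hom_ext _ (CFP.hom_ext hfst (Category.id_comp _)), ?_, ?_, ?_⟩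
  · change IsIso (𝟙 XD)
    infer_instance
  · exact Category.comp_id _
  · exact Category.id_comp _

/-! ### The tower `towerA`: the factorisation "pull-back after base-isomorphism" (Fac) -/

/-- (Fac) for `A`: every arrow `φ` of `A` factors as `φ = β ≫ α` where `β = (β₀, 𝟙)` lies over an
identity of `D` and the `C₀`-component `α₀ = (Base φ₀, 1, 1)` of `α` is the pull-back morphism of `C₀`
out of the object carrying the pulled-back angular region `A_K|_L` (Def. 3.1 (iv)); `β₀ = (𝟙, d, c)` is
the cartesian factorisation of `φ₀` through it. This is "`φ₀ = α₀ ∘ β₀` … lifts naturally to a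
factorization `φ = α ∘ β` in `F`, where `β` projects to an isomorphism `β_D` of `D`" (p. 33 ll. 17–20).
[cite: MochizukiFrdII2008, Prop 3.4 (viii) p.33] -/
theorem A.exists_fac_pullback {X Y : (towerA π).F} (φ : X ⟶ Y) :
    ∃ (Z : (towerA π).F) (β : X ⟶ Z) (α : Z ⟶ Y), β ≫ α = φ ∧ IsIso ((towerA π).toD.map β) ∧
      PreFrobenioid.IsPullbackMorphism C0.toElem α.hom.fst := by
  obtain ⟨⟨X0, XD, ιX⟩⟩ := X
  obtain ⟨⟨Y0, YD, ιY⟩⟩ := Y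
  obtain ⟨⟨f0, fD, w⟩, hf⟩ := φ
  change X0 ⟶ Y0 at f0
  change XD ⟶ YD at fD
  obtain ⟨Ap, hA, b0, a0, hcomp, hbβ, hbα, hdβ, hsβ, hdivβ, hdα, hsα, hisoα, hcar⟩ :=
    C0.exists_factor_pullRegion f0 (𝟙 X0.base) (C0.Base f0) (Category.id_comp _)
  have hpb : PreFrobenioid.IsPullbackMorphism C0.toElem a0 :=
    C0.isPullbackMorphism_of_region_eq a0 hdα hsα (by rw [hbα]; exact hcar)
  let Z : (towerA π).F := ⟨⟨C0.mk X0.base Ap hA, XD, ιX⟩⟩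
  have wβ : (PreFrobenioid.baseFunctor C0.toElem).map b0 ≫ ιX.hom = ιX.hom ≫ π.map (𝟙 XD) := by
    change C0.Base b0 ≫ ιX.hom = ιX.hom ≫ π.map (𝟙 XD)
    rw [hbβ, CategoryTheory.Functor.map_id, Category.id_comp, Category.comp_id]
  have wα : (PreFrobenioid.baseFunctor C0.toElem).map a0 ≫ ιY.hom = ιX.hom ≫ π.map fD := by
    change C0.Base a0 ≫ ιY.hom = ιX.hom ≫ π.map fD
    rw [hbα]
    exact w
  have hdivβ' : PreFrobenioid.Div C0.toElem b0 = PreFrobenioid.Div C0.toElem f0 := hdivβ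
  have hdivα' : PreFrobenioid.Div C0.toElem a0 = 1 := hisoα
  have pβ : PreFrobenioid.isometricMorphisms (C.toElem π)
      (⟨b0, 𝟙 XD, wβ⟩ : (⟨X0, XD, ιX⟩ : C π) ⟶ ⟨C0.mk X0.base Ap hA, XD, ιX⟩) := by
    change pull _ _ (PreFrobenioid.Div C0.toElem b0) = 1
    rw [hdivβ']
    exact hf
  have pα : PreFrobenioid.isometricMorphisms (C.toElem π)
      (⟨a0, fD, wα⟩ : (⟨C0.mk X0.base Ap hA, XD, ιX⟩ : C π) ⟶ ⟨Y0, YD, ιY⟩) := by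
    change pull _ _ (PreFrobenioid.Div C0.toElem a0) = 1
    rw [hdivα', map_one]
  refine ⟨Z, ⟨⟨b0, 𝟙 XD, wβ⟩, pβ⟩, ⟨⟨a0, fD, wα⟩, pα⟩,
    WideSubcategory.hom_ext _ (CFP.hom_ext hcomp (Category.id_comp _)), ?_, hpb⟩
  change IsIso (𝟙 XD)
  infer_instance

/-! ### The tower `towerA`: item (vi) refined for arrows with pull-back `C₀`-component (LiftD) -/

/-- (LiftD) for `A` — item (vi) refined: if the `C₀`-component of `α : Z → Y` is a pull-back morphism
of `C₀` and `α_D = δ ≫ χ` in `D`, then `α = α₁ ≫ α₂` in `A` with `α₁`, `α₂` lifting `δ`, `χ` (the middle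
object projecting to the middle object of `D` on the nose) AND with pull-back `C₀`-components: the
construction is t6's (Prop. 3.4 (vi), `C.exists_factor`: the middle object carries the pulled-back
region `A_Y|_χ`, `α₂ = (π(χ), 1, 1)`, `α₁ = (π(δ), 1, c_α)`), and `c_α · A_Z = A_Y|_{α}` transfers to
`α₁` by the transitivity of base change. [cite: MochizukiFrdII2008, Prop 3.4 (vi) p.30] -/
theorem A.exists_factor_pullback {Z Y : (towerA π).F} (α : Z ⟶ Y)
    (hP : PreFrobenioid.IsPullbackMorphism C0.toElem α.hom.fst)
    {E : D} (δ : (towerA π).toD.obj Z ⟶ E) (χ : E ⟶ (towerA π).toD.obj Y)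
    (hfac : δ ≫ χ = (towerA π).toD.map α) :
    ∃ (Z' : (towerA π).F) (α₁ : Z ⟶ Z') (α₂ : Z' ⟶ Y) (i : (towerA π).toD.obj Z' ≅ E),
      α₁ ≫ α₂ = α ∧ (towerA π).toD.map α₁ ≫ i.hom = δ ∧ i.inv ≫ (towerA π).toD.map α₂ = χ ∧
        PreFrobenioid.IsPullbackMorphism C0.toElem α₁.hom.fst ∧
        PreFrobenioid.IsPullbackMorphism C0.toElem α₂.hom.fst := by
  obtain ⟨⟨Z0, ZD, ιZ⟩⟩ := Z
  obtain ⟨⟨Y0, YD, ιY⟩⟩ := Y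
  obtain ⟨⟨a0, aD, w⟩, ha⟩ := α
  change Z0 ⟶ Y0 at a0
  change ZD ⟶ YD at aD
  change ZD ⟶ E at δ
  change E ⟶ YD at χ
  change δ ≫ χ = aD at hfac
  change PreFrobenioid.IsPullbackMorphism C0.toElem a0 at hP
  have w'' : (PreFrobenioid.baseFunctor C0.toElem).map a0 = (ιZ.hom ≫ π.map aD) ≫ ιY.inv :=
    (Iso.eq_comp_inv ιY).mpr w
  have hb : (ιZ.hom ≫ π.map δ) ≫ (π.map χ ≫ ιY.inv) = C0.Base a0 :=
    calc (ιZ.hom ≫ π.map δ) ≫ (π.map χ ≫ ιY.inv)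
        = (ιZ.hom ≫ π.map (δ ≫ χ)) ≫ ιY.inv := by simp only [Functor.map_comp, Category.assoc]
      _ = (ιZ.hom ≫ π.map aD) ≫ ιY.inv := by rw [hfac]
      _ = (PreFrobenioid.baseFunctor C0.toElem).map a0 := w''.symm
  obtain ⟨Am, hA, b0, c0, hcomp, hbβ, hbα, hdβ, hsβ, hdivβ, hdα, hsα, hisoα, hcar⟩ :=
    C0.exists_factor_pullRegion a0 (ιZ.hom ≫ π.map δ) (π.map χ ≫ ιY.inv) hb
  -- the two `C₀`-components are pull-back morphisms
  obtain ⟨hd_a0, hfull⟩ := (C0.isPullbackMorphism_iff a0).1 hP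
  have hcar' : (C0.mk (π.obj E) Am hA).region.carrier = C0.pullRegion Y0 (C0.Base c0) := by
    rw [hbα]; exact hcar
  have hpb₂ : PreFrobenioid.IsPullbackMorphism C0.toElem c0 :=
    C0.isPullbackMorphism_of_region_eq c0 hdα hsα hcar'
  have hpb₁ : PreFrobenioid.IsPullbackMorphism C0.toElem b0 :=
    C0.isPullbackMorphism_left_of_region_eq b0 c0 (hdβ.trans hd_a0) hdα hsα hcar'
      (by rw [hcomp]; exact hfull)
  -- the lift to `A`, as in t6's `C.exists_factor` / `A.propVI`
  let E0 : C0 := ⟨π.obj E, Am, hA⟩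
  let E' : C π := ⟨E0, E, Iso.refl _⟩
  have hbβ' : (PreFrobenioid.baseFunctor C0.toElem).map b0 = ιZ.hom ≫ π.map δ := hbβ
  have hbα' : (PreFrobenioid.baseFunctor C0.toElem).map c0 = π.map χ ≫ ιY.inv := hbα
  have wβ : (PreFrobenioid.baseFunctor C0.toElem).map b0 ≫ E'.iso.hom = ιZ.hom ≫ π.map δ :=
    (Category.comp_id _).trans hbβ'
  have wα : (PreFrobenioid.baseFunctor C0.toElem).map c0 ≫ ιY.hom = E'.iso.hom ≫ π.map χ :=
    ((Iso.eq_comp_inv ιY).mp hbα').trans (Category.id_comp _).symm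
  have hdivβ' : PreFrobenioid.Div C0.toElem b0 = PreFrobenioid.Div C0.toElem a0 := hdivβ
  have hdivα' : PreFrobenioid.Div C0.toElem c0 = 1 := hisoα
  have pβ : PreFrobenioid.isometricMorphisms (C.toElem π)
      (⟨b0, δ, wβ⟩ : (⟨Z0, ZD, ιZ⟩ : C π) ⟶ E') := by
    change pull _ _ (PreFrobenioid.Div C0.toElem b0) = 1
    rw [hdivβ']
    exact ha
  have pα : PreFrobenioid.isometricMorphisms (C.toElem π) (⟨c0, χ, wα⟩ : E' ⟶ ⟨Y0, YD, ιY⟩) := by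
    change pull _ _ (PreFrobenioid.Div C0.toElem c0) = 1
    rw [hdivα', map_one]
  refine ⟨⟨E'⟩, ⟨⟨b0, δ, wβ⟩, pβ⟩, ⟨⟨c0, χ, wα⟩, pα⟩, Iso.refl E,
    WideSubcategory.hom_ext _ (CFP.hom_ext hcomp hfac), Category.comp_id _, Category.id_comp _,
    hpb₁, hpb₂⟩

/-! ### The tower `towerA`: item (vii) and item (v) in the shapes consumed by the assembly -/

/-- (vii) for `A` in the shape of the assembly: an arrow of `A` whose `C₀`-component is a pull-back
morphism of `C₀` projects to a pull-back morphism of `A₀` (`A0.isPullbackMorphism_of_hom`), so the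
typed item (vii) (`(towerA π).PropVII`, by name) makes it an FSMI-morphism as soon as its
`D`-component is one. [cite: MochizukiFrdII2008, Prop 3.4 (vii) p.30] -/
theorem A.isFSMI_of_isPullbackMorphism_fst_of_propVII (hVII : (towerA π).PropVII)
    {Z Y : (towerA π).F} (α : Z ⟶ Y) (hP : PreFrobenioid.IsPullbackMorphism C0.toElem α.hom.fst)
    (hD : IsFSMI ((towerA π).toD.map α)) : IsFSMI α :=
  (hVII α (A0.isPullbackMorphism_of_hom ((towerA π).toF0.map α) hP)).2 hD

end ArchFrd

end

end Literature.AlgebraicGeometry.Frobenioids
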